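import Summits.QuantumFields.QCD.Theses.SpectralDefectExtinction
import Literature.MathematicalPhysics.QuantumFieldTheory.QuasiLocalGaugePerturbation
import Literature.MathematicalPhysics.QuantumFieldTheory.QCD

/-!
# `ExtinctionBuildsQCD` (crux stmt-QuantumFields-18064, SD⁺ → THR) — negative-side support:
# THE COERCIVE FORMAT HAS A FREE NORMALISATION (`act ∅` is invisible to every norm)

Cdisprove seat g3 (2026-08-17), §9a of `Cruxes/ExtinctionBuildsQCD/Disproof.lean`.  The picked line
`block-away-the-sign` (skeleton v13, stub G1 `stub_seaBlockFormat`) must place the UNNORMALISED honest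
all-antiperiodic sea weight `w_{k,S} = e^{−β_k S_W}·Re∏_f det D_W^{AP}(m_f(k))` in the coercive positive format
of the node `RobustYangMillsRG` (stmt-17812 rev 3): `∫ G(Bl U) w(U) dU = ∫ G(V) e^{−βe_k A(V) − W(V)} F(LF_ε V, V) dV`
with `‖A‖_{κ} ≤ A₀`, `‖W‖_{κ} ≤ B₀` (weighted polymer norms), `F(∅,·) = 1`, all constants uniform in `k, S`.
A disprover's first idea is a TOTAL-MASS MISMATCH: `∫ w_{k,S} dU = e^{−Θ((2S+1)⁴)}` (free energy per FINE site)
against a format exponent bounded per COARSE site, `b_k⁴ = (ℓ₀/a_k)⁴ → ∞` fine sites each.  THIS FILE SHOWS THAT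
THE ATTACK IS VOID and, for the provers, that NORMALISATION IS NOT LOAD-BEARING in G1 / in format membership:

* `constShift W c` — the perturbation `W` with its EMPTY-polymer activity shifted by the constant `c`
  (`polymers b = (blockCorners b).powerset ∋ ∅`, and an activity supported on `polymerEdges b ∅ = ∅` is a constant);
  `total_constShift : (constShift W c).total U = W.total U + c`;
* the norms do not see it: `weightedSum_constShift`, `normLE_constShift_iff`, `hasAnalyticNormLE_constShift_iff`
  (the weighted sums run over `polymersThrough b y = {X ∋ y}`, which excludes `∅`); nor does the support-diameter
  clause (`supportClause_constShift_iff`) or any clause phrased through differences `A.total V − A.total 1`;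
* `integral_identity_smul` — the push-forward identity scales: if `(A, W, F)` represents `w` then
  `(A, constShift W (−log c), F)` represents `c·w` (`exp_format_constShift`);
* `posFormatClause_smul` — consequently the verbatim `∃ (A W F), …` clause of the line's `BlockFormatPosAt`
  (here `PosFormatClause`, for an arbitrary coarse side `M`) holds for `c·w` as soon as it holds for `w`, for every
  constant `c > 0` (which may depend on `k` and `S`): membership of the honest weight and of its normalisation
  `w/∫w` are EQUIVALENT, and no bound on `∫ w dU` can refute G1 or the node.

LOAD-BEARING READING.  What the format constrains is the SHAPE of the blocked density on small coarse fields
(`log ρ` quasi-local with `k,S`-uniform weighted norms, coercive principal part) and its size relative to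
`e^{−βe A − W}` on rough ones — never its total mass.
-/

noncomputable section

namespace Summit.QuantumFields.QCD.Theorems.ExtinctionBuildsQCD.Negative.FormatFreeConstant

open scoped BigOperators Classical Matrix.Norms.Frobenius
open MeasureTheory Finset
open Literature.MathematicalPhysics.QuantumLattice Literature.MathematicalPhysics.QuantumFieldTheory
  Literature.Probability.LatticeModels
open Summit.QuantumFields.QCD.Theses.SpectralDefectExtinction

section ConstShift

variable {d L : ℕ} [NeZero L] {G : Type*} [Group G] [MeasurableSpace G] {b : ℕ}

/-- **The empty-polymer shift**: `W` with the activity of the empty polymer moved by the constant `c`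
(all other activities unchanged).  It stays in the class: a constant depends on no link, is gauge invariant,
measurable and bounded. -/
def constShift (W : QuasiLocalGaugePerturbation d L G b) (c : ℝ) : QuasiLocalGaugePerturbation d L G b where
  act X U := W.act X U + if X = ∅ then c else 0
  dependsOn' X := fun _ _ h => by dsimp only; rw [W.dependsOn' X h]
  gaugeInvariant' X := fun g U => by dsimp only; rw [W.gaugeInvariant' X g U]
  measurable' X := (W.measurable' X).add measurable_const
  bounded' X := by
    obtain ⟨C, hC⟩ := W.bounded' X
    refine ⟨C + |c|, fun U => (abs_add_le _ _).trans (add_le_add (hC U) ?_)⟩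
    split_ifs <;> simp

variable (W : QuasiLocalGaugePerturbation d L G b) (c : ℝ)

/-- The shifted activities (definitional). -/
@[simp] theorem constShift_act (X : Finset (Site d L)) (U : GaugeConfig d L G) :
    (constShift W c).act X U = W.act X U + if X = ∅ then c else 0 := rfl

/-- Non-empty polymers keep their activities. -/
theorem constShift_act_of_ne {X : Finset (Site d L)} (hX : X ≠ ∅) (U : GaugeConfig d L G) :
    (constShift W c).act X U = W.act X U := by
  simp [hX]

/-- Shifts compose additively. -/
theorem constShift_constShift (c' : ℝ) : constShift (constShift W c) c' = constShift W (c + c') := by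
  ext X U
  simp only [constShift_act]
  split_ifs <;> ring

/-- The zero shift is the identity. -/
@[simp] theorem constShift_zero : constShift W 0 = W := by
  ext X U
  simp

/-- **The total perturbation moves by the constant**: `(constShift W c).total = W.total + c`
(the empty set is a polymer: `polymers b = (blockCorners b).powerset`). -/
theorem total_constShift (U : GaugeConfig d L G) : (constShift W c).total U = W.total U + c := by
  have h0 : (∅ : Finset (Site d L)) ∈ polymers (d := d) (L := L) b := mem_polymers_iff.2 (empty_subset _)
  simp only [QuasiLocalGaugePerturbation.total, constShift_act, sum_add_distrib, sum_ite_eq', if_pos h0]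

/-- Sup norms of non-empty polymers are unchanged. -/
theorem supNorm_constShift_of_ne {X : Finset (Site d L)} (hX : X ≠ ∅) :
    (constShift W c).supNorm X = W.supNorm X := by
  simp only [QuasiLocalGaugePerturbation.supNorm, constShift_act_of_ne W c hX]

/-- **The weighted sums through every block do not see the shift** (they run over polymers CONTAINING the
block, hence never over `∅`). -/
theorem weightedSum_constShift (κ : ℝ) (y : Site d L) :
    (constShift W c).weightedSum κ y = W.weightedSum κ y := by
  refine sum_congr rfl fun X hX => ?_
  rw [supNorm_constShift_of_ne W c (ne_empty_of_mem (mem_polymersThrough_iff.1 hX).2)]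

/-- **The weighted (Kotecký–Preiss) norm bound is invariant under the shift.** -/
theorem normLE_constShift_iff (κ η : ℝ) : (constShift W c).NormLE κ η ↔ W.NormLE κ η := by
  simp only [QuasiLocalGaugePerturbation.NormLE, weightedSum_constShift]

/-- The analytic norm bound survives the shift (the empty polymer's extension is shifted by `c`, its bound by
`|c|`; no weighted sum involves it). -/
theorem hasAnalyticNormLE_constShift {N : ℕ} (ρ : G →* Matrix (Fin N) (Fin N) ℂ)
    (D : Finset (Site d L) → Set (ComplexGaugeConfig d L N)) {κ η : ℝ}
    (h : W.HasAnalyticNormLE ρ D κ η) : (constShift W c).HasAnalyticNormLE ρ D κ η := by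
  obtain ⟨M, hA, hM⟩ := h
  refine ⟨fun X => if X = ∅ then M X + |c| else M X, fun X hX => ?_, fun y hy => ?_⟩
  · obtain ⟨F, hF, hFW, hFM⟩ := hA X hX
    by_cases hXe : X = ∅
    · subst hXe
      refine ⟨fun Z => F Z + c, ?_, fun U hU => ?_, fun Z hZ => ?_⟩
      · exact hF.add_const (c : ℂ)
      · simp only [hFW U hU, constShift_act, if_true]
        push_cast
        ring
      · dsimp only
        rw [if_pos rfl]
        calc ‖F Z + c‖ ≤ ‖F Z‖ + ‖(c : ℂ)‖ := norm_add_le _ _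
          _ ≤ M ∅ + |c| := add_le_add (hFM Z hZ) (by rw [Complex.norm_real, Real.norm_eq_abs])
    · refine ⟨F, hF, fun U hU => by rw [hFW U hU, constShift_act_of_ne W c hXe], fun Z hZ => ?_⟩
      dsimp only
      rw [if_neg hXe]
      exact hFM Z hZ
  · refine le_trans (le_of_eq (sum_congr rfl fun X hX => ?_)) (hM y hy)
    dsimp only
    rw [if_neg (ne_empty_of_mem (mem_polymersThrough_iff.1 hX).2)]

/-- **The analytic norm bound is invariant under the shift.** -/
theorem hasAnalyticNormLE_constShift_iff {N : ℕ} (ρ : G →* Matrix (Fin N) (Fin N) ℂ)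
    (D : Finset (Site d L) → Set (ComplexGaugeConfig d L N)) (κ η : ℝ) :
    (constShift W c).HasAnalyticNormLE ρ D κ η ↔ W.HasAnalyticNormLE ρ D κ η := by
  refine ⟨fun h => ?_, hasAnalyticNormLE_constShift W c ρ D⟩
  have h' := hasAnalyticNormLE_constShift (constShift W c) (-c) ρ D h
  rwa [constShift_constShift, add_neg_cancel, constShift_zero] at h'

/-- The support-diameter clause of the format (`act X ≢ 0 ⇒ X` has diameter `≤ |X|` in every direction) is
invariant under the shift: for `X = ∅` its conclusion is vacuous, elsewhere the activities agree. -/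
theorem supportClause_constShift_iff :
    (∀ X ∈ polymers (d := d) (L := L) b, (∃ V, (constShift W c).act X V ≠ 0) → ∀ y ∈ X, ∀ y' ∈ X, ∀ i,
        (y i - y' i).val ≤ X.card ∨ (y' i - y i).val ≤ X.card) ↔
      (∀ X ∈ polymers (d := d) (L := L) b, (∃ V, W.act X V ≠ 0) → ∀ y ∈ X, ∀ y' ∈ X, ∀ i,
        (y i - y' i).val ≤ X.card ∨ (y' i - y i).val ≤ X.card) := by
  refine forall₂_congr fun X _ => ?_
  by_cases hXe : X = ∅
  · subst hXe
    simp
  · simp only [constShift_act_of_ne W c hXe]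

/-- **The exponent bookkeeping**: shifting `W` by `c` multiplies the format density by `e^{−c}`. -/
theorem exp_format_constShift {M : Type*} (A : M → ℝ) (β : ℝ) (V : GaugeConfig d L G) (x : M) :
    Real.exp (-(β * A x) - (constShift W c).total V) = Real.exp (-c) * Real.exp (-(β * A x) - W.total V) := by
  rw [total_constShift, ← Real.exp_add]
  congr 1
  ring

end ConstShift

/-- **The push-forward identity scales** (pure measure theory: both sides are linear in the weight). -/
theorem integral_identity_smul {α γ : Type*} [MeasurableSpace α] [MeasurableSpace γ] {μ : Measure α}
    {ν : Measure γ} {Bl : α → γ} {w : α → ℝ} {ρ : γ → ℝ}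
    (h : ∀ Gf : γ → ℝ, Measurable Gf → (∃ C, ∀ V, |Gf V| ≤ C) →
      ∫ U, Gf (Bl U) * w U ∂μ = ∫ V, Gf V * ρ V ∂ν)
    (c : ℝ) :
    ∀ Gf : γ → ℝ, Measurable Gf → (∃ C, ∀ V, |Gf V| ≤ C) →
      ∫ U, Gf (Bl U) * (c * w U) ∂μ = ∫ V, Gf V * (c * ρ V) ∂ν := by
  intro Gf hG hb
  have e1 : (fun U => Gf (Bl U) * (c * w U)) = fun U => c * (Gf (Bl U) * w U) := by funext U; ring
  have e2 : (fun V => Gf V * (c * ρ V)) = fun V => c * (Gf V * ρ V) := by funext V; ring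
  rw [e1, e2, integral_const_mul, integral_const_mul, h Gf hG hb]

section Format

/-- **`PosFormatClause` — the coercive positive-format clause VERBATIM** (the `∃ (A W F), …` tail of the line's
`BlockFormatPosAt ε r B₀ κ c₀ cA A₀ a ℓ₀ w βe Bl k S`, skeleton v13 of `Lines/block_away_the_sign.lean`, with the
coarse side `Mside a ℓ₀ k S` generalised to any `M`, the fine weight `w k S ↦ w`, the blocking `Bl k S ↦ Bl` and
the block coupling `βe k ↦ βek`): `A` quasi-local analytic coercive with `‖A‖ ≤ A₀`, `W` analytic with `‖W‖ ≤ B₀`,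
`F` the non-negative rough-region factor, and the push-forward identity. -/
def PosFormatClause (ε r B₀ κ c₀ cA A₀ : ℝ) (M : ℕ) [NeZero M] {S : ℕ}
    (w : GaugeConfig 4 (2 * S + 1) SU3 → ℝ) (βek : ℝ)
    (Bl : GaugeConfig 4 (2 * S + 1) SU3 → GaugeConfig 4 M SU3) : Prop :=
  ∃ (A W : QuasiLocalGaugePerturbation 4 M SU3 1)
    (F : Finset (Site 4 M) → GaugeConfig 4 M SU3 → ℝ),
    A.HasAnalyticNormLE (fundamentalRep (Fin 3)) (smallFieldDomain (fundamentalRep (Fin 3)) 1 r ε) κ A₀ ∧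
    A.NormLE κ A₀ ∧
    (∀ X ∈ polymers 1, (∃ V, A.act X V ≠ 0) → ∀ y ∈ X, ∀ y' ∈ X, ∀ i,
      (y i - y' i).val ≤ X.card ∨ (y' i - y i).val ≤ X.card) ∧
    (∀ V, cA * wilsonAction (fundamentalRep (Fin 3)) V ≤ A.total V - A.total fun _ => 1) ∧
    W.HasAnalyticNormLE (fundamentalRep (Fin 3)) (smallFieldDomain (fundamentalRep (Fin 3)) 1 r ε) κ B₀ ∧
    W.NormLE κ B₀ ∧
    (∀ X ∈ polymers 1, (∃ V, W.act X V ≠ 0) → ∀ y ∈ X, ∀ y' ∈ X, ∀ i,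
      (y i - y' i).val ≤ X.card ∨ (y' i - y i).val ≤ X.card) ∧
    (∀ Z, Measurable (F Z)) ∧ (∀ V, F ∅ V = 1) ∧ (∀ Z V, 0 ≤ F Z V) ∧
    (∀ Z V, |F Z V| ≤ Real.exp (c₀ * Z.card)) ∧
    (∀ Z (n : ℕ) V V', (∀ e, (∃ y ∈ Z, ∀ i, (e.1 i - y i).val ≤ n ∨ (y i - e.1 i).val ≤ n) → V e = V' e) →
      |F Z V - F Z V'| ≤ Real.exp (c₀ * Z.card + κ * (4 - n))) ∧
    (∀ Z₁ Z₂ (n : ℕ), (∀ y ∈ Z₁, ∀ y' ∈ Z₂, ∃ i, n < (y i - y' i).val ∧ n < (y' i - y i).val) →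
      ∀ V, |F (Z₁ ∪ Z₂) V - F Z₁ V * F Z₂ V| ≤ Real.exp (c₀ * (Z₁.card + Z₂.card) + κ * (4 - n))) ∧
    ∀ Gf, Measurable Gf → (∃ C, ∀ V, |Gf V| ≤ C) →
      ∫ U, Gf (Bl U) * w U ∂(Measure.pi fun _ => haarProbability SU3) =
        ∫ V, Gf V * (Real.exp (-(βek * A.total V) - W.total V) *
          F (Finset.univ.filter fun y => ∃ i j : Fin 4,
            ε < 3 - ((fundamentalRep (Fin 3)) (plaquetteHolonomy V y i j)).trace.re) V)
          ∂(Measure.pi fun _ => haarProbability SU3)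

/-- **NORMALISATION IS NOT LOAD-BEARING.** If the weight `w` is in the coercive positive format with constants
`(ε, r, B₀, κ, c₀, cA, A₀)` and block coupling `βek`, then so is `c·w` for every constant `c > 0`, with the SAME
constants, coupling, blocking, principal part `A` and rough factor `F` — only the empty-polymer activity of `W`
moves (by `−log c`).  In particular format membership of the honest sea weight `w_{k,S}` and of its normalisation
`w_{k,S}/∫w_{k,S}` (or any `c_{k,S} > 0` times it) are equivalent, `k` by `k` and `S` by `S`. -/
theorem posFormatClause_smul {ε r B₀ κ c₀ cA A₀ : ℝ} {M : ℕ} [NeZero M] {S : ℕ}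
    {w : GaugeConfig 4 (2 * S + 1) SU3 → ℝ} {βek : ℝ}
    {Bl : GaugeConfig 4 (2 * S + 1) SU3 → GaugeConfig 4 M SU3} {c : ℝ} (hc : 0 < c)
    (h : PosFormatClause ε r B₀ κ c₀ cA A₀ M w βek Bl) :
    PosFormatClause ε r B₀ κ c₀ cA A₀ M (fun U => c * w U) βek Bl := by
  obtain ⟨A, W, F, hA1, hA2, hA3, hA4, hW1, hW2, hW3, hF1, hF2, hF3, hF4, hF5, hF6, hId⟩ := h
  refine ⟨A, constShift W (-Real.log c), F, hA1, hA2, hA3, hA4,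
    hasAnalyticNormLE_constShift W _ _ _ hW1, (normLE_constShift_iff W _ κ B₀).2 hW2,
    (supportClause_constShift_iff W _).2 hW3, hF1, hF2, hF3, hF4, hF5, hF6, fun Gf hG hb => ?_⟩
  have key := integral_identity_smul hId c Gf hG hb
  rw [key]
  refine integral_congr_ae (Filter.Eventually.of_forall fun V => ?_)
  simp only [exp_format_constShift, neg_neg, Real.exp_log hc]
  ring

end Format

end Summit.QuantumFields.QCD.Theorems.ExtinctionBuildsQCD.Negative.FormatFreeConstant

end
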